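import Summits.FinalStateConjecture.FinalStateConjecture.Theorems.NeckGapDecay.Negative.ExactSchwarzschildGapCertificate
import Summits.FinalStateConjecture.FinalStateConjecture.Theorems.StarvedNecksNeckGapDecayStubCertOfCore
import Summits.FinalStateConjecture.FinalStateConjecture.Theorems.StarvedNecksNeckGapDecayStubSlowSmoothMinorant
import Summits.FinalStateConjecture.FinalStateConjecture.Theorems.StarvedNecksNeckGapDecayStubWallMajorant
import HarnessLib

/-!
# The reshaped physics stub is not vacuous: the gap CORE certificate holds on exact Schwarzschild
# (crux `StarvedNecks.NeckGapDecay`, stmt-FinalStateConjecture-16768, line `Sketch`; model check of P-core `stub_gapCoreCert`)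

The v7/v8 reshape of the line `Sketch` replaced the physics stub P″ (`GapAnalyticCert` for some normalised wall) by
P-core: SOME normalised dominating wall `W` and a `GapCoreCert` (`…CertOfCoreStub.GapCoreCert`: chart of the annular late
tube beyond a RECEDING seam `ϱ → ∞`, matched to the input chart to third order across the seam collar, `C²`-certified
beyond the seam, far annulus separated from the input chart's inner image).  This file checks the new clauses — the seam
regularity `|ϱ′|, |ϱ″|, |ϱ‴| ≤ 1`, `ϱ ≥ R₁ + M + 1`, `Tendsto ϱ atTop atTop` with the input certificate out to `ϱ + 6`,
the matching clause (C2) with its `C³` decay, (C1), (C3) and the separation (C4) — against the honest exact model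
`SchwGap.decompK P 4` of the crux disprover (`Negative/ExactSchwarzschildLateModel`, `…GapCertificate`): they are
JOINTLY satisfiable there by the intended witness `R₁ = R₀`, `τ₁ = max 1 T₀`, `ϱ` = the slow smooth minorant of the
identity above `R₀ + M + 1` (stub W4), `Ψ' = Ψᵢ` (the identity hole chart), `T = id`, for EVERY continuous wall `W` and
threshold `T₀` (`gapCoreCert_decompK`); and with the normalised dominating wall of stub S1 (`WallMajorant`) the model
satisfies the exact CONCLUSION shape of P-core (`gapCoreConclusion_decompK`).  So the reshape introduced no typing slip
that would make P-core false for a silly reason on honest inputs; what it does not show is the physics (the model's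
deviation vanishes identically).  References: Kerr–Schild 1965 §3; DHRT arXiv:2104.08222 §1.  No new definitions.
-/

noncomputable section

open TopologicalSpace Manifold Filter Topology Set Function
open scoped ContDiff Topology ENNReal Manifold

-- instance search through nested operator types `E4 →L E4 →L E4 →L ℝ` (as in the tree files)
set_option maxSynthPendingDepth 3

namespace Summit.FinalStateConjecture.FinalStateConjecture.Theorems.NeckGapDecay.ConnectionLevelCones.GapCoreModel

open Literature.Geometry.Lorentzian
open Summit.FinalStateConjecture.FinalStateConjecture.Theorems.SeamedChartsExhaust.Negative
open Summit.FinalStateConjecture.FinalStateConjecture.Theorems.SeamedChartsExhaust.Negative.SchwModel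
open Summit.FinalStateConjecture.FinalStateConjecture.Theorems.NeckGapDecay.Negative
open Summit.FinalStateConjecture.FinalStateConjecture.Theorems.NeckGapDecay.ConnectionLevelCones.CertOfCoreStub

set_option linter.dupNamespace false

/-- **The gap CORE certificate holds on exact Schwarzschild**, for every continuous wall `W` and threshold `T₀`,
with the intended witness `R₁ = R₀`, `τ₁ = max 1 T₀`, `ϱ` a slow smooth receding seam radius above `R₀ + M + 1` (W4
below the identity), `Ψ' = Ψᵢ`, `T = id` (the deviation of the identity hole chart vanishes identically; `Ψᵢ` is the
inclusion, so matching, certificates and separation are immediate). [folklore] -/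
theorem gapCoreCert_decompK (P : Params) (T₀ : ℝ) (W : ℝ → ℝ) (hW : Continuous W)
    (i : Fin (SchwGap.decompK P 4).N) :
    GapCoreCert (ST P) (O P) (SchwGap.decompK P 4) P.R₀ i T₀ W := by
  -- the receding seam radius (stub W4 below the identity)
  obtain ⟨ϱ, hϱs, -, hϱtop, hϱb, -, hϱ1, hϱ2, hϱ3⟩ :=
    SlowSmoothMinorantStub.stub_slowSmoothMinorant (fun u ↦ u) (P.R₀ + P.M + 1) monotone_id tendsto_id
  refine ⟨P.R₀, max 1 T₀, ϱ, Ψ P, fun y ↦ y, le_rfl, le_rfl,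
    ⟨hϱs, hϱ1, hϱ2, hϱ3, fun u ↦ hϱb u, hϱtop, ?_⟩, ⟨?_, ?_, ?_⟩, ⟨contDiff_id, ?_, ?_⟩, ?_, ?_⟩
  · -- the input certificate out to `ϱ + 6`: the deviation vanishes identically
    simp_rw [SchwGap.decompK_background, SchwGap.decompK_chart, truncDeviationCk_Ψ]
    exact tendsto_const_nhds
  · -- (C1a) smooth
    exact (contMDiff_inclusion (n := ∞) (hbext P)).contMDiffOn
  · -- (C1b) open embedding of the (open) annular late tube
    set Aset : Set (boostedKerrBackground 1 0 P.M 0).domain :=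
      {x | max 1 T₀ < (boostedKerrBackground 1 0 P.M 0).time x.1 ∧
        ϱ ((boostedKerrBackground 1 0 P.M 0).time x.1) + 1 <
          E4.spatialNorm (poincareInv ((SchwGap.decompK P 4).motion i).1 ((SchwGap.decompK P 4).motion i).2 x.1) ∧
        (boostedKerrBackground 1 0 P.M 0).radius x.1 < W (x.1 0) + 1} with hAset
    have hopen : IsOpen Aset := by
      have h1 : Continuous fun x : (boostedKerrBackground 1 0 P.M 0).domain ↦
          (boostedKerrBackground 1 0 P.M 0).time x.1 :=
        ((PiLp.continuous_apply 2 _ 0).comp (continuous_poincareInv 1 0)).comp continuous_subtype_val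
      have h2 : Continuous fun x : (boostedKerrBackground 1 0 P.M 0).domain ↦
          (boostedKerrBackground 1 0 P.M 0).radius x.1 :=
        ((Kerr.continuous_radius 0).comp (continuous_poincareInv 1 0)).comp continuous_subtype_val
      have h3 : Continuous fun x : (boostedKerrBackground 1 0 P.M 0).domain ↦ W (x.1 0) + 1 :=
        (hW.comp ((PiLp.continuous_apply 2 _ 0).comp continuous_subtype_val)).add continuous_const
      have h4 : Continuous fun x : (boostedKerrBackground 1 0 P.M 0).domain ↦
          ϱ ((boostedKerrBackground 1 0 P.M 0).time x.1) + 1 := (hϱs.continuous.comp h1).add continuous_const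
      have h5 : Continuous fun x : (boostedKerrBackground 1 0 P.M 0).domain ↦
          E4.spatialNorm (poincareInv ((SchwGap.decompK P 4).motion i).1 ((SchwGap.decompK P 4).motion i).2 x.1) :=
        ((continuous_norm.comp E4.spatial.continuous).comp (continuous_poincareInv _ _)).comp continuous_subtype_val
      exact (isOpen_lt continuous_const h1).inter ((isOpen_lt h4 h5).inter (isOpen_lt h2 h3))
    have hg : IsOpenEmbedding (fun x : Aset ↦ (x.1.1 : E4)) :=
      (boostedKerrExterior 1 0 P.M 0).2.isOpenEmbedding_subtypeVal.comp hopen.isOpenEmbedding_subtypeVal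
    have hcar : IsOpenEmbedding (Subtype.val : (ST P).carrier → E4) := (Kerr.region 0 P.r₀).2.isOpenEmbedding_subtypeVal
    exact IsOpenEmbedding.of_comp _ hcar hg
  · -- (C1c) image in the charted late region (the hole region of the model)
    rintro _ ⟨x, ⟨hx1, -⟩, rfl⟩
    refine FinalStateDecomposition.region_subset_charted _ i ⟨x, ?_, rfl⟩
    show (1 : ℝ) < _
    exact lt_of_le_of_lt (le_max_left 1 T₀) hx1
  · -- (C2) matching: `T = id`, `Ψ' = Ψᵢ`
    intro x _ _ _
    exact ⟨x.2, by rw [SchwGap.decompK_chart]; rfl⟩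
  · -- (C2) decay: `T − id = 0`
    have h0 : (fun y : E4 ↦ y - y) = 0 := by funext y; simp
    simp_rw [h0, supCkENorm_zero]
    exact tendsto_const_nhds
  · -- (C3) the deviation of the identity chart vanishes identically
    simp_rw [SchwGap.decompK_background, deviationExtend_Ψ, supCkENorm_zero]
    exact tendsto_const_nhds
  · -- (C4) separation: `Ψᵢ` is injective
    intro x y _ hxs _ _ hys h
    rw [SchwGap.decompK_chart] at h
    have hxy : x = y := by
      have h1 : (Ψ P x).1 = (Ψ P y).1 := by rw [h]
      rw [Ψ_val, Ψ_val] at h1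
      exact Subtype.ext h1
    subst hxy
    linarith

/-- **P-core's conclusion shape on the model**: with the normalised wall of stub S1 (`WallMajorant`) dominating
`3ρ + 2` (`ρ = R₀ + 1 + √·` the model's excision), the exact CONCLUSION of `GapCoreCertHolds` holds for every hole of
`SchwGap.decompK P 4`. [folklore] -/
theorem gapCoreConclusion_decompK (P : Params) (i : Fin (SchwGap.decompK P 4).N) :
    ∃ (T₀ : ℝ) (W : ℝ → ℝ), Continuous W ∧ Monotone W ∧ Tendsto (fun s ↦ W s / s) atTop (𝓝 0) ∧
      (∀ s s', s ≤ s' → W s' ≤ W s +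
        1 / (10 * ‖((((SchwGap.decompK P 4).motion i).1 : E4 ≃L[ℝ] E4) : E4 →L[ℝ] E4)‖ ^ 2) * (s' - s)) ∧
      (∀ s, P.R₀ + 2 ≤ W s) ∧ (∀ s, T₀ ≤ s → 3 * (SchwGap.decompK P 4).excision i s + 2 ≤ W s) ∧
      GapCoreCert (ST P) (O P) (SchwGap.decompK P 4) P.R₀ i T₀ W := by
  have hε : 0 < 1 / (10 * ‖((((SchwGap.decompK P 4).motion i).1 : E4 ≃L[ℝ] E4) : E4 →L[ℝ] E4)‖ ^ 2) := by
    rw [SchwGap.decompK_motion]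
    have h1 : ((((1 : lorentzGroup), (0 : E4)).1 : E4 ≃L[ℝ] E4) : E4 →L[ℝ] E4) = ContinuousLinearMap.id ℝ E4 := rfl
    rw [h1]
    have h2 : ‖ContinuousLinearMap.id ℝ E4‖ = 1 := ContinuousLinearMap.norm_id
    rw [h2]; norm_num
  obtain ⟨T₀, W, hWc, hWm, hWs, hWl, hWR, hWall⟩ :=
    WallMajorantStub.stub_wallMajorant (ρ P) (ρ_div_tendsto P) _ (P.R₀ + 2) hε
  refine ⟨T₀, W, hWc, hWm, hWs, hWl, hWR, fun s hs ↦ ?_, gapCoreCert_decompK P T₀ W hWc i⟩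
  rw [SchwGap.decompK_excision]
  exact hWall s hs

end Summit.FinalStateConjecture.FinalStateConjecture.Theorems.NeckGapDecay.ConnectionLevelCones.GapCoreModel

end
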